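import Summits.BirchSwinnertonDyer.Rank1Residual.Additive.LocalZpExtension
import HarnessLib

/-!
# The local `ℤ_p`-extension `κ ∘ res : Γ_{K_v} ↠ ℤ_p` with a PRESCRIBED topological generator (tool for the
# ♭-local lift LOC♭ at the place above `p`; part 19a)

Seat `bsd-2adic-ss-1` GEN 13, crux `SupersingularRankZeroAtTwo` (stmt-BirchSwinnertonDyer-19097), line
`flat_uniform_two`, conjunct COUNT♭@2 input `hloc2`. A corollary of `Rank1Residual.Additive.exists_localZpExtension`
(which picks its own generator): rescaling by a unit (`ZpExtension.unitTwist`) makes the given `g` — the local lift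
of the cyclotomic generator carried by the ♭ Coleman data — the topological generator. Consumer: part 19
(`…FlatLocalLiftTwo.lean`, `ZpExtension.exists_extend` along this extension). Nothing about any curve is asserted;
BSD is not proved by any of this.

References: [GreenbergLNM1716] §3 p. 87 («`K_η` … `ℤ_p`-extension of `F_v`»); [Washington1997] §13.1.
-/

set_option autoImplicit false
-- the Theorems namespace of this sub repeats the summit name by design (D-0017 nested layout)
set_option linter.dupNamespace false

noncomputable section

open scoped Classical NumberField

open Literature.NumberTheory.EllipticCurves Literature.NumberTheory.GaloisRepresentations
  Summit.BirchSwinnertonDyer.Rank1Residual.Additive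

universe u

namespace Summit.BirchSwinnertonDyer.BirchSwinnertonDyer.Theorems.SSFlatEC

variable {K : Type u} [Field K] {p : ℕ} [Fact p.Prime] (κ : ZpExtension K p) (E : Type u) [Field E] [Algebra K E]

/-- The local `ℤ_p`-extension `κ ∘ res : Γ_E ↠ ℤ_p` with the prescribed generator: if `g ∈ Γ_E` restricts
to a topological generator of `κ`, there is a `ℤ_p`-extension of `E` with kernel `Gal(Ē/K_∞·E)` and
topological generator `g`. [cite: GreenbergLNM1716, §3 p. 87] -/
theorem exists_localZpExtension_of_isTopGenerator {g : Field.absoluteGaloisGroup E}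
    (hg : κ.IsTopGenerator (resGal (K := K) E g)) :
    ∃ κE : ZpExtension E p, κE.kerSubgroup = localSubgroup κ.kerSubgroup E ∧ κE.IsTopGenerator g := by
  have hE : ∃ δ : Field.absoluteGaloisGroup E, resGal (K := K) E δ ∉ κ.kerSubgroup := by
    refine ⟨g, fun h ↦ ?_⟩
    rw [ZpExtension.mem_kerSubgroup] at h
    have h1 : (Multiplicative.ofAdd (1 : ℤ_[p])) = 1 := hg.symm.trans h
    exact one_ne_zero (Multiplicative.ofAdd.injective (h1.trans ofAdd_zero.symm))
  obtain ⟨κE₀, g₀, hker, hγ₀, hform⟩ := exists_localZpExtension κ E hE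
  -- `κ(res g) = 1 = κE₀(g) · κ(res g₀)`: the rescaling factor is a unit with inverse `κE₀ g`
  have h1 : (κ (resGal (K := K) E g)).toAdd = 1 := by rw [hg]; rfl
  have hu : (κE₀ g).toAdd * (κ (resGal (K := K) E g₀)).toAdd = 1 := by rw [← hform g, h1]
  let u : ℤ_[p]ˣ := Units.mkOfMulEqOne _ _ (by rw [mul_comm]; exact hu)
  refine ⟨κE₀.unitTwist u, by rw [ZpExtension.kerSubgroup_unitTwist, hker], ?_⟩
  change κE₀.unitTwist u g = Multiplicative.ofAdd 1
  rw [ZpExtension.unitTwist_apply]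
  congr 1
  change (κ (resGal (K := K) E g₀)).toAdd * (κE₀ g).toAdd = 1
  rw [mul_comm]; exact hu

end Summit.BirchSwinnertonDyer.BirchSwinnertonDyer.Theorems.SSFlatEC

end
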